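import Literature.MathematicalPhysics.QuantumFieldTheory.Balaban1983to89.Node00.TorusCoverLandau153RecTower
import Literature.MathematicalPhysics.QuantumFieldTheory.Balaban1983to89.B8Eq191FlatLettersDentedCubeMemberRec

/-!
# NODE 00 — THE R7 DOOR, STAGE 1 WITH THE ALL-LEVELS GRADIENT LETTER (pen (j-iii) «(T2b)» of plan g93's WORD A3⁵, first link): [Balaban1985Variational] (152) member 2
# «(Lʲη)²|∇^η A| ≤ …» READ AT EVERY LEVEL OF THE DENTED RECORD TOWER for the EXPORTED member gauge `u_m`, plus the crown's `|∇^η A|_(−2) ≤ r` row passed through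

Cell `pub-ymgap`, width seat `pub-ymgap-dag-n07-w3` g12 (N05-REC → K-road junction; plan g93 WORD A3⁵ = ρ3 «φ-form», pen (j-iii) = (T2b)).  NEW leaf, ONE theorem; CONSUMED BY NAME,
nothing modified: this lineage's g10 STAGE 1 `Node00.TorusCoverLandau153RecTower` (`exists_suGauge_letters152_recTower_member`, `sideTouches_of_mem_fam`,
`CubeB8DZ.mem_sq_zero_iff_inBox ∕ cube_top_subset_sq_pred ∕ sq_zero_subset_tcube`), `Node00.TorusCoverPropSixGaugeLevels.norm_logCfg_sub_le_of_msup_grad_at` (the p. 86 `(−2)`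
supremum READ AT ANY LEVEL `m ≤ k`), this seat's g11 `B8Eq191FlatLettersDentedCubeMemberRec.sq_antitone`.  `--kind proof --supports stmt-QuantumFields-20541` (K0⁷; count-neutral).
[6] = [Balaban1985RegularSpaces]; [15] = [Balaban1985Variational]; [I] = [Balaban1987RG1].

WHY.  The junction of record (✓p739534 `…N07Thm4RecMemberOfRecordCrownSU.hThm4RecMember_uniform_holds`) delivers `HThm4RecMember`, whose GRADIENT row is read at the top box
only (`∀ q ∈ regionOfSet(π″□).dpairs, ‖grad‖ < κ·ε_j`), while print's (152) member 2 is level-weighted: «(L^{j′}η)²|∇^η A| ≤ B·ε on □_{j′}» for every `j′` — the conjunct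
(T2b) of the ρ3 head's premise `HThm4RecSym152` (dag-n07-e).  The information is in the crown (`GaugedBoundB8DZ` ∕ `DatumCrownAt` conjunct 8: `msup … (−2) … covDerivFwd … ≤ r`,
all levels) but the R7 door chain CONSUMES it at STAGE 1 (level `k − 1` only) and exports the member gauge `u_m` without it.  THIS FILE is STAGE 1 re-run with TWO more exported
conjuncts on the SAME `u_m` (which IS the crown's `u`): (xiv) `∀ j ≤ k, ∀ x μ ν, x, x + e_μ ∈ Ω′_j → ‖A′(x + e_μ, ν) − A′(x, ν)‖ ≤ 2·(η·r·((Lʲη)²)⁻¹)` (`A′ = logCfg η (U₀″^{u_m⁻¹})`;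
window `Ω′₀`, `norm_logCfg_sub_le_of_msup_grad_at` at level `j`), (xv) the `msup` row itself.  STAGES 2–3 (window push-down, door), `HThm4RecMember152` and the torus reading of
(xiv) on `regionOfSet(π″□_{j′}).dpairs` follow the same pass-through (road memo `HOME/pub-ymgap-dag-n07-w3/T2B-ROAD.md`).

WHAT THIS FILE PROVES.  ★★ `exists_suGauge_letters152_recTower_member_grad` — statement = `exists_suGauge_letters152_recTower_member` VERBATIM + conjuncts (xiv), (xv); proof = g10's
verbatim + two tuple entries.
HONEST FRAMING: count-neutral; bookkeeping; nothing of [6]∕[15]∕[I] asserted; (T2b) itself (torus side) NOT yet typed; `HThm4Rec*` premises CONDITIONAL; N05 ∕ N07 NOT discharged;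
COUNT 8∕27 · K 1∕4 UNMOVED; one finite 𝕋⁴ programme at fixed ε — R4 closes the conditional finite-𝕋⁴ rung `BalabanLadder.UV` only; the YM mass gap (Clay) is NOT proved by any of
this; nothing continuum ∕ ℝ⁴ ∕ OS.  No `def`, no `instance`, no `notation`, no `sorry`.

[cite: Balaban1985Variational, (152) p.301, (144)–(153) pp.300–301; Balaban1985RegularSpaces, Prop. 6 (1.135)–(1.138) p.99, (1.29) p.81, (1.131) p.99; Balaban1985Averaging, (78)–(81) p.30; Balaban1987RG1, (0.3)–(0.4) pp.252–253]
-/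

noncomputable section

namespace Literature.MathematicalPhysics.QuantumFieldTheory.Balaban1983to89.Node00

open scoped Matrix.Norms.L2Operator
open B7Prop1Explicit (e e_apply gaugeAct)
open B7Prop1Local (InBox AgreeOn)
open B7Prop2Explicit (unitaryUnits mem_unitaryUnits)
open B7Prop2SpecialUnitary (specialUnitaryUnits mem_specialUnitaryUnits)
open BlockAveragingZd (avgIterZ ctrShift)
open B8Ineq132 (covDerivFwd covDeriv BondTouches)
open B8Eq131Cubes (tLo tHi ctr gs)
open B8Eq131CubesRec (boxZ cubeZ tcubeZ bLoZ bHiZ)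
open B8Eq140Level (SideTouches sideTouches_of_bondTouches)
open B8Eq138LandauZd (logCfg covDivB covLap)
open B8Eq138LandauZdRec (IsLandau138Z IsLandau138WZ)
open B8Eq119TwistedAxialRec (Restr129Z)
open B7SectEFLinearisationRec (logCovIterZ)
open B8Eq184Proof (cfgExp)
open B8LeafModelZd3 (mlogCfg)
open B8ScaledSupNorm (msup Bdd bondNorm)
open B8Eq146AExpansion (plaqCovDeriv iEta)
open B8Eq143PlaqExpansion (pdiv)
open MatrixLog (mlog)

variable {d N : ℕ} [NeZero N]

section RecTowerGrad

variable {L K : ℕ} {Ω : ℕ → Set (B7Prop1Explicit.Site d)}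

/-- ★★ **STAGE 1 OF THE R7 DOOR WITH THE ALL-LEVELS GRADIENT LETTER AND THE `(−2)` ROW EXPORTED** — `exists_suGauge_letters152_recTower_member` (g10) VERBATIM plus, for the SAME
exported member gauge `u_m` (= the crown's `u`): (xiv) [15] (152) member 2 at every level `j ≤ k` of the dented record tower — `‖A′(x + e_μ, ν) − A′(x, ν)‖ ≤ 2·(η·r·((Lʲη)²)⁻¹)`
for `x, x + e_μ ∈ Ω′_j`, `A′ = logCfg η (U₀″^{u_m⁻¹})` (the `(−2)`-weighted supremum read at level `j` through the window `Ω′₀`); (xv) the crown's `msup … (−2) … ≤ r` row itself.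
[cite: Balaban1985Variational, (152) p.301; Balaban1985RegularSpaces, Prop. 6 (1.135)–(1.136) p.99, (1.29) p.81, (1.131) p.99, p.77; Balaban1985Averaging, (78)–(81) p.30; Balaban1987RG1, (0.3)–(0.4) pp.252–253] -/
theorem exists_suGauge_letters152_recTower_member_grad (hd : 2 ≤ d) (hLo : Odd L) (hL : 2 ≤ L) (c : CubeB8DZ d L K Ω)
    (V : B7Prop1Explicit.Site d → Fin d → (MatA N)ˣ) (hV : ∀ x μ, V x μ ∈ specialUnitaryUnits (Fin N)) {η r : ℝ} (hη : 0 < η) (hr : 0 ≤ r)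
    (hG : letI : CStarAlgebra (MatA N) := {};
      ∃ u : B7Prop1Explicit.Site d → (MatA N)ˣ, (∀ x, u x ∈ specialUnitaryUnits (Fin N)) ∧ (∀ x, x ∉ c.sq 0 → u x = 1) ∧
        Restr129Z L c.k c.lamS (1 : B7Prop1Explicit.Site d → Fin d → (MatA N)ˣ) u ∧
        IsLandau138WZ L c.k η (c.sq 0) c.lamS (1 : B7Prop1Explicit.Site d → Fin d → (MatA N)ˣ) (c.fixed V u) ∧
        (∀ j, j ≤ c.k → ∀ b ∈ {b : B7Prop1Explicit.Site d × Fin d | SideTouches (c.sq j) b.1 b.2},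
          c.fixed V u b.1 b.2 = cfgExp η (logCfg η (c.fixed V u)) b.1 b.2 ∧ IsSelfAdjoint (logCfg η (c.fixed V u) b.1 b.2) ∧
            ‖logCfg η (c.fixed V u) b.1 b.2‖ ≤ r * ((L : ℝ) ^ j * η)⁻¹) ∧
        (∀ x, ((c.vfix V)⁻¹ * u) x ∈ specialUnitaryUnits (Fin N)) ∧
        AgreeOn (B8Ineq130Rec.tlo L (tLo c.a c.ρ) c.k) (B8Ineq130Rec.thi L (tHi c.a c.M c.ρ) c.k) (gaugeAct ((c.vfix V)⁻¹ * u)⁻¹ V) (c.fixed V u) ∧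
        msup L c.k η (-(2 : ℝ)) (fun j (t : Fin d × Fin d × B7Prop1Explicit.Site d) => SideTouches (c.sq j) t.2.2 t.2.1)
            (fun t => covDerivFwd η (1 : B7Prop1Explicit.Site d → Fin d → (MatA N)ˣ) t.1 (fun z => c.expo η V u z t.2.1) t.2.2) ≤ r ∧
        bondNorm L c.k η (-(3 : ℝ)) c.sq
            (fun x μ => pdiv η (1 : B7Prop1Explicit.Site d → Fin d → (MatA N)ˣ) (plaqCovDeriv η (1 : B7Prop1Explicit.Site d → Fin d → (MatA N)ˣ) (c.expo η V u)) μ x) ≤ r ∧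
        bondNorm L c.k η (-(3 : ℝ)) c.sq (fun x μ => covLap η (1 : B7Prop1Explicit.Site d → Fin d → (MatA N)ˣ) (fun z => c.expo η V u z μ) x) ≤ r ∧
        (∀ (x : B7Prop1Explicit.Site d) (μ : Fin d), bLoZ L c.a 0 0 ≤ x → x + e μ ≤ bHiZ L c.a c.M 0 0 → c.inTop x → c.inTop (x + e μ) →
          logCovIterZ L (1 : B7Prop1Explicit.Site d → Fin d → (MatA N)ˣ) (iEta η (c.expo η V u)) c.k x μ =
            mlog ((avgIterZ L (c.axial V) c.k x μ : (MatA N)ˣ) : MatA N)))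
    (hsmall : 4 * ((N : ℝ) * r) < 2 * Real.pi) :
    letI : CStarAlgebra (MatA N) := {}
    ∃ s : B7Prop1Explicit.Site d → Matrix.specialUnitaryGroup (Fin N) ℂ, ∃ um : B7Prop1Explicit.Site d → (MatA N)ˣ,
      (∀ x μ, x ∈ c.sq 0 → x + e μ ∈ c.sq 0 →
          gaugeAct (fun y => ιSU N (s y)) V x μ = cfgExp η (logCfg η (c.fixed V um)) x μ) ∧
      (∀ j, j ≤ c.k → ∀ x μ, x ∈ c.sq j → x + e μ ∈ c.sq j → ‖logCfg η (c.fixed V um) x μ‖ ≤ 2 * (r * ((L : ℝ) ^ j * η)⁻¹)) ∧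
      (∀ x μ, x ∈ cubeZ L c.a c.M c.ρ c.k c.k → x + e μ ∈ cubeZ L c.a c.M c.ρ c.k c.k →
          ‖logCfg η (c.fixed V um) x μ‖ ≤ 2 * (r * ((L : ℝ) ^ (c.k - 1) * η)⁻¹)) ∧
      (∀ x μ ν, x ∈ cubeZ L c.a c.M c.ρ c.k c.k → x + e μ ∈ cubeZ L c.a c.M c.ρ c.k c.k → x + e ν ∈ cubeZ L c.a c.M c.ρ c.k c.k →
          ‖logCfg η (c.fixed V um) (x + e μ) ν - logCfg η (c.fixed V um) x ν‖ ≤ 2 * (η * r * (((L : ℝ) ^ (c.k - 1) * η) ^ 2)⁻¹)) ∧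
      (∀ x μ, x ∈ cubeZ L c.a c.M c.ρ c.k c.k → x + e μ ∈ cubeZ L c.a c.M c.ρ c.k c.k →
          (∀ ν, x + e ν ∈ cubeZ L c.a c.M c.ρ c.k c.k ∧ x - e ν ∈ cubeZ L c.a c.M c.ρ c.k c.k ∧ x - e ν + e μ ∈ cubeZ L c.a c.M c.ρ c.k c.k) →
          ‖pdiv η (1 : B7Prop1Explicit.Site d → Fin d → (MatA N)ˣ) (plaqCovDeriv η 1 (logCfg η (c.fixed V um))) μ x‖ ≤
            2 * (r * (((L : ℝ) ^ (c.k - 1) * η) ^ 3)⁻¹)) ∧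
      (∀ x μ, x ∈ cubeZ L c.a c.M c.ρ c.k c.k → x + e μ ∈ cubeZ L c.a c.M c.ρ c.k c.k →
          (∀ ν, x + e ν ∈ cubeZ L c.a c.M c.ρ c.k c.k ∧ x - e ν ∈ cubeZ L c.a c.M c.ρ c.k c.k) →
          ‖covLap η (1 : B7Prop1Explicit.Site d → Fin d → (MatA N)ˣ) (fun z => logCfg η (c.fixed V um) z μ) x‖ ≤ 2 * (r * (((L : ℝ) ^ (c.k - 1) * η) ^ 3)⁻¹)) ∧
      IsLandau138Z L c.k η (c.sq 0) c.lamS (1 : B7Prop1Explicit.Site d → Fin d → (MatA N)ˣ) (logCfg η (c.fixed V um)) ∧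
      (∀ x, x ∈ c.sq 0 → ιSU N (s x) = (um x)⁻¹ * c.vfix V x) ∧
      (∀ x, um x ∈ specialUnitaryUnits (Fin N)) ∧ (∀ x, x ∉ c.sq 0 → um x = 1) ∧
      Restr129Z L c.k c.lamS (1 : B7Prop1Explicit.Site d → Fin d → (MatA N)ˣ) um ∧
      (∀ (x : B7Prop1Explicit.Site d) (μ : Fin d), bLoZ L c.a 0 0 ≤ x → x + e μ ≤ bHiZ L c.a c.M 0 0 → c.inTop x → c.inTop (x + e μ) →
        logCovIterZ L (1 : B7Prop1Explicit.Site d → Fin d → (MatA N)ˣ) (iEta η (c.expo η V um)) c.k x μ =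
          mlog ((avgIterZ L (c.axial V) c.k x μ : (MatA N)ˣ) : MatA N)) ∧
      -- ★ NEW (T2b input): (152) member 2 read at EVERY level of the dented tower, for the EXPORTED member gauge `um`
      (∀ j, j ≤ c.k → ∀ x μ ν, x ∈ c.sq j → x + e μ ∈ c.sq j →
          ‖logCfg η (c.fixed V um) (x + e μ) ν - logCfg η (c.fixed V um) x ν‖ ≤ 2 * (η * r * (((L : ℝ) ^ j * η) ^ 2)⁻¹)) ∧
      -- ★ NEW (pass-through): the crown's `|∇^η A|_(−2) ≤ r` row itself, for `um`
      msup L c.k η (-(2 : ℝ)) (fun j (t : Fin d × Fin d × B7Prop1Explicit.Site d) => SideTouches (c.sq j) t.2.2 t.2.1)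
          (fun t => covDerivFwd η (1 : B7Prop1Explicit.Site d → Fin d → (MatA N)ˣ) t.1 (fun z => c.expo η V um z t.2.1) t.2.2) ≤ r := by
  letI : CStarAlgebra (MatA N) := {}
  have hL1 : 1 ≤ L := le_trans (by norm_num) hL
  have hk1 : c.k - 1 ≤ c.k := Nat.sub_le _ _
  obtain ⟨u, hu, hoff, h129, h138, h162, hw, h135, h136₂, h136₃, h136₄, h137⟩ := hG
  set w : B7Prop1Explicit.Site d → (MatA N)ˣ := (c.vfix V)⁻¹ * u with hwdef
  set U₁ : B7Prop1Explicit.Site d → Fin d → (MatA N)ˣ := c.fixed V u with hU₁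
  have h138' : IsLandau138Z L c.k η (c.sq 0) c.lamS (1 : B7Prop1Explicit.Site d → Fin d → (MatA N)ˣ) (logCfg η U₁) := h138
  have h136' : ∀ j, j ≤ c.k → ∀ b ∈ {b : B7Prop1Explicit.Site d × Fin d | SideTouches (c.sq j) b.1 b.2},
      ‖logCfg η U₁ b.1 b.2‖ ≤ r * ((L : ℝ) ^ j * η)⁻¹ := fun j hj b hb => (h162 j hj b hb).2.2
  -- `□₀` as a centred `InBox`, inside `□̃`
  set lo₀ : B7Prop1Explicit.Site d := bLoZ L c.a c.k (c.ρ * gs L c.k) with hlo₀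
  set hi₀ : B7Prop1Explicit.Site d := bHiZ L c.a c.M c.k (c.ρ * gs L c.k) with hhi₀
  have hsq : ∀ x, InBox lo₀ hi₀ x ↔ x ∈ c.sq 0 := fun x => (CubeB8DZ.mem_sq_zero_iff_inBox hLo c x).symm
  have hsqT : c.sq 0 ⊆ tcubeZ L c.a c.M c.ρ c.k := CubeB8DZ.sq_zero_subset_tcube hLo hL c
  -- the data of the SU normalisation on the box `□₀`: `w⁻¹` is `SU(N)`-valued
  have hg : ∀ x, InBox lo₀ hi₀ x → w⁻¹ x ∈ specialUnitaryUnits (Fin N) := fun x _ => by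
    rw [Pi.inv_apply]; exact (specialUnitaryUnits (Fin N)).inv_mem (hw x)
  have hgauge : ∀ x μ, InBox lo₀ hi₀ x → InBox lo₀ hi₀ (x + e μ) → gaugeAct w⁻¹ V x μ = cfgExp η (logCfg η U₁) x μ := by
    intro x μ hx hx'
    have hx0 := (hsq x).1 hx
    rw [h135 x μ (hsqT hx0) (hsqT ((hsq _).1 hx'))]
    exact (h162 0 (Nat.zero_le _) (x, μ) (sideTouches_of_mem_fam hd hx0 μ)).1
  have hsa : ∀ x μ, InBox lo₀ hi₀ x → InBox lo₀ hi₀ (x + e μ) → IsSelfAdjoint (logCfg η U₁ x μ) := fun x μ hx _ =>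
    (h162 0 (Nat.zero_le _) (x, μ) (sideTouches_of_mem_fam hd ((hsq x).1 hx) μ)).2.1
  have hA : ∀ x μ, InBox lo₀ hi₀ x → InBox lo₀ hi₀ (x + e μ) → η * (N * ‖logCfg η U₁ x μ‖) ≤ N * r := by
    intro x μ hx _
    have h := h136' 0 (Nat.zero_le _) (x, μ) (sideTouches_of_mem_fam hd ((hsq x).1 hx) μ)
    simp only [pow_zero, one_mul] at h
    have hN : (0 : ℝ) ≤ N := Nat.cast_nonneg N
    calc η * (N * ‖logCfg η U₁ x μ‖) ≤ η * (N * (r * η⁻¹)) := mul_le_mul_of_nonneg_left (mul_le_mul_of_nonneg_left h hN) hη.le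
      _ = N * r := by field_simp
  have hVdet : ∀ x μ, InBox lo₀ hi₀ x → InBox lo₀ hi₀ (x + e μ) → ((V x μ : (MatA N)ˣ) : MatA N).det = 1 := fun x μ _ _ =>
    (Matrix.mem_specialUnitaryGroup_iff.1 (hV x μ)).2
  obtain ⟨s, hs, -, hsg⟩ := exists_suGauge_of_specialUnitaryGauge_local lo₀ hi₀ hη V w⁻¹ (logCfg η U₁) hVdet hg hgauge hsa hA hsmall
  -- the pure top cube `□_k` lies in `Ω′_{k−1}`: every bond based in it is a side touching the tower (the window of the unmasked readings)
  have htop : cubeZ L c.a c.M c.ρ c.k c.k ⊆ c.sq (c.k - 1) := CubeB8DZ.cube_top_subset_sq_pred hLo c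
  have hW : ∀ y ∈ cubeZ L c.a c.M c.ρ c.k c.k, ∀ τ : Fin d, ∃ j, j ≤ c.k ∧ SideTouches (c.sq j) y τ :=
    fun y hy τ => ⟨c.k - 1, hk1, sideTouches_of_mem_fam hd (htop hy) τ⟩
  -- weakening `t ≤ 2t` for the nonnegative letters
  have h2 : ∀ {a t : ℝ}, 0 ≤ t → a ≤ t → a ≤ 2 * t := fun ht h => h.trans (by linarith)
  have hLη : ∀ j : ℕ, 0 ≤ r * ((L : ℝ) ^ j * η)⁻¹ := fun j => by positivity
  refine ⟨s, u, fun x μ hx hx' => hsg x μ ((hsq x).2 hx) ((hsq _).2 hx'), fun j hj x μ hx _ => ?_, fun x μ hx _ => ?_, fun x μ ν hx hx' _ => ?_,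
    fun x μ hx hx' hν => ?_, fun x μ hx _ hν => ?_, h138', fun x hx => ?_, hu, hoff, h129, h137, fun j hj x μ ν hx hx' => ?_, h136₂⟩
  · exact h2 (hLη j) (h136' j hj (x, μ) (sideTouches_of_mem_fam hd hx μ))
  · exact h2 (hLη (c.k - 1)) (h136' (c.k - 1) hk1 (x, μ) (sideTouches_of_mem_fam hd (htop hx) μ))
  · exact h2 (by positivity) (norm_logCfg_sub_le_of_msup_grad_at c.sq c.k hL1 hη hr U₁ h136' h136₂ hW hk1 hx hx'
      (sideTouches_of_mem_fam hd (htop hx) ν))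
  · exact h2 (by positivity) (norm_codiff_logCfg_le_at c.sq c.k hL1 hη hr U₁ h136' h136₃ hW hk1 hx hx' hν (Or.inl (htop hx)))
  · exact h2 (by positivity) (norm_lap_logCfg_le_at c.sq c.k hL1 hη hr U₁ h136' h136₄ hW hk1 hx (fun ν => ⟨(hν ν).1, (hν ν).2⟩) (Or.inl (htop hx)))
  · rw [hs x ((hsq x).2 hx), hwdef]
    simp only [Pi.inv_apply, Pi.mul_apply, mul_inv_rev, inv_inv]
  · -- the new all-levels gradient letter: window `W := Ω′₀` (every site of `Ω′₀` is a side of a plaquette touching `Ω′₀`), level `j`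
    have hW0 : ∀ y ∈ c.sq 0, ∀ τ : Fin d, ∃ j', j' ≤ c.k ∧ SideTouches (c.sq j') y τ :=
      fun y hy τ => ⟨0, Nat.zero_le _, sideTouches_of_mem_fam hd hy τ⟩
    have hsub : c.sq j ⊆ c.sq 0 := B8Eq191FlatLettersDentedCubeMemberRec.sq_antitone c hLo (Nat.zero_le j)
    exact h2 (by positivity) (norm_logCfg_sub_le_of_msup_grad_at c.sq c.k hL1 hη hr U₁ h136' h136₂ hW0 hj (hsub hx) (hsub hx')
      (sideTouches_of_mem_fam hd hx ν))

end RecTowerGrad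

end Literature.MathematicalPhysics.QuantumFieldTheory.Balaban1983to89.Node00

end

/-! ## Axiom audit (gate whitelist: `propext`, `Classical.choice`, `Quot.sound`) -/
#print axioms Literature.MathematicalPhysics.QuantumFieldTheory.Balaban1983to89.Node00.exists_suGauge_letters152_recTower_member_grad
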